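import Mathlib
import Summits.NavierStokesRegularity.NavierStokesRegularity.Theorems.EulerZoomLiouvillePowerGaugeEulerLiouvilleSelfSimilarKelvinFlow
import Literature.Analysis.FluidPDE.SpaceTimeCalculusC1
import Literature.Analysis.FluidPDE.WholeSpaceIBP
import Literature.Analysis.FluidPDE.BiotSavartCurlPair
import HarnessLib.Audit

/-!
# Rung C1 of the crux `EulerZoomLiouville.PowerGaugeEulerLiouville`: the SELF-SIMILAR KELVIN LAW
# (circulation along the self-similar Lagrangian flow decays like `e^{(2γ−1)s}`)

Route №10 `EulerZoomLiouville` (NavierStokesRegularity), crux E = stmt-NavierStokesRegularity-19832,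
tenure rung C1 (exactly self-similar members), registered residue `stub_selfSimilarExtremal`.
PROFILE-LEVEL statement for a classical stationary self-similar Euler profile `(V, P)`
(`IsSelfSimilarEulerProfile γ 0 V P`, CIV 2026 (3.3)) with `V` smooth and `‖DV‖ ≤ K`; the flow
`Φ_s = ODE.evolutionMap (fun _ => γy + V) 0 s` of the self-similar Lagrangian field is the one of
`…SelfSimilarKelvinFlow` (Jacobian `e^{3γs}`, outgoing far trajectories):

* `hasDerivAt_inner_flow` — the Weber–Kelvin computation along the flow:
  `d/ds ⟪V(Φ_s y), DΦ_s(y) b⟫ = (2γ−1)⟪V(Φ_s y), DΦ_s(y) b⟫ + DG(Φ_s y)[DΦ_s(y) b]`, `G = ½|V|² − P`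
  (profile equation + `DW = γ I + DV`);
* `integral_inner_flow_eq_exp_mul` — **the self-similar Kelvin law, torus-averaged** (CIV 2026
  §3.4.2, `e^{(1−2γ)s} Γ(s) = Γ(0)` for the circulation along the image of a loop; here the loop
  is replaced by a compactly supported divergence-free test field `B`, i.e. an average over a
  solid torus of loops, which is what the far-field energy argument of the sequel pairs with
  `V ∈ L²`): for every `s`,
  `∫ ⟪V(Φ_s y), DΦ_s(y) B(y)⟫ dy = e^{(2γ−1)s} ∫ ⟪V, B⟫`
  (differentiate under the integral on the compact support of `B`; the extra term integrates to
  `−∫ (G∘Φ_s) div B = 0`).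

The sequel `…SelfSimilarKelvinFarField` turns this into: at the energy-conserving endpoint
`γ = 2/5` (`ρ = 1/2`), polynomial decay of the tail energy `∫_{|x|>R}|V|²` forces `curl V` to
have compact support, whence (tree, `selfSimilar_ae_eq_zero_of_hasCompactSupport_curl`) the
member is trivial — the classical endpoint stratum of `stub_selfSimilarExtremal`
(Chae–Wolf 2020 Cor. 1.5 in the self-similar case, by a new elementary route, without the
named fact `chaeWolf2020_dss_energyConservingScale`).

WHAT THIS IS NOT: not NS, not E, not rung C1 — an identity for CLASSICAL (smooth,
bounded-gradient) profiles only; it constrains nothing by itself.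

## References

* P. Constantin, M. Ignatova, V. Vicol, arXiv:2602.17570 (2026), §3.4.1 (self-similar Weber
  formula), §3.4.2 (self-similar Kelvin circulation theorem, Remark 3.6).
  [ConstantinIgnatovaVicol2026Putative]
* J. Leray, Acta Math. 63 (1934), §6 (1.11) (integration by parts, the tree's `WholeSpaceIBP`).
  [Leray1934]
-/

noncomputable section

-- flat `Theorems/<Route><Decl>…` files of one crux share the namespace of the crux (tree convention)
set_option linter.dupNamespace false

open MeasureTheory Set Filter Topology Metric Function InnerProductSpace
open scoped RealInnerProductSpace NNReal ContDiff

namespace Summit.NavierStokesRegularity.NavierStokesRegularity.Theorems.PowerGaugeEulerLiouville.Kelvin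

open Literature.Analysis Literature.Analysis.FluidPDE

variable {γ : ℝ} {V : EuclideanSpace ℝ (Fin 3) → EuclideanSpace ℝ (Fin 3)}

/-! ### The self-similar Kelvin law -/

/-- **The Weber–Kelvin computation along the self-similar flow** (CIV 2026 §3.4.1, the display
before (3.23): `∂_τ((∇Y)ᵀU(Y)) + (1−2γ)(∇Y)ᵀU(Y) + ∇(P(Y) − ½|U(Y)|²) = 0`): for a classical
profile and every vector `b`,
`d/ds ⟪V(Φ_s y), DΦ_s(y) b⟫ = (2γ−1)⟪V(Φ_s y), DΦ_s(y) b⟫ + DG(Φ_s y)[DΦ_s(y) b]`, `G = ½|V|² − P`.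
[cite: ConstantinIgnatovaVicol2026Putative, §3.4.1 (self-similar Weber formula)] -/
theorem hasDerivAt_inner_flow (hV : ContDiff ℝ ∞ V) {K : ℝ} (hK : ∀ y, ‖fderiv ℝ V y‖ ≤ K)
    {P : EuclideanSpace ℝ (Fin 3) → ℝ} (hprof : IsSelfSimilarEulerProfile γ 0 V P) (s : ℝ)
    (y b : EuclideanSpace ℝ (Fin 3)) :
    HasDerivAt (fun r => ⟪V (ODE.evolutionMap (fun _ : ℝ => selfSimilarTransport γ 0 V) 0 r y),
        fderiv ℝ (ODE.evolutionMap (fun _ : ℝ => selfSimilarTransport γ 0 V) 0 r) y b⟫)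
      ((2 * γ - 1) * ⟪V (ODE.evolutionMap (fun _ : ℝ => selfSimilarTransport γ 0 V) 0 s y),
          fderiv ℝ (ODE.evolutionMap (fun _ : ℝ => selfSimilarTransport γ 0 V) 0 s) y b⟫ +
        fderiv ℝ (fun z => (1 / 2 : ℝ) * ‖V z‖ ^ 2 - P z)
          (ODE.evolutionMap (fun _ : ℝ => selfSimilarTransport γ 0 V) 0 s y)
          (fderiv ℝ (ODE.evolutionMap (fun _ : ℝ => selfSimilarTransport γ 0 V) 0 s) y b)) s := by
  set Φ := ODE.evolutionMap (fun _ : ℝ => selfSimilarTransport γ 0 V) 0 with hΦ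
  have hVd : Differentiable ℝ V := hprof.contDiff_velocity.differentiable (by norm_num)
  have hPd : Differentiable ℝ P := hprof.contDiff_pressure.differentiable one_ne_zero
  -- the two factors
  have h1 : HasDerivAt (fun r => V (Φ r y))
      (fderiv ℝ V (Φ s y) (selfSimilarTransport γ 0 V (Φ s y))) s :=
    (hVd (Φ s y)).hasFDerivAt.comp_hasDerivAt s (hasDerivAt_flow (γ := γ) hV hK s y)
  have h2 : HasDerivAt (fun r => fderiv ℝ (Φ r) y b)
      ((γ • ContinuousLinearMap.id ℝ (EuclideanSpace ℝ (Fin 3)) + fderiv ℝ V (Φ s y))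
        (fderiv ℝ (Φ s) y b)) s := by
    refine ((hasDerivAt_fderiv_flow (γ := γ) hV hK s y).clm_apply (hasDerivAt_const s b)).congr_deriv ?_
    simp [hΦ]
  have h3 := h1.inner ℝ h2
  -- the derivative of `G = ½|V|² − P`
  have hG : HasFDerivAt (fun z => (1 / 2 : ℝ) * ‖V z‖ ^ 2 - P z)
      ((1 / 2 : ℝ) • ((innerSL ℝ (V (Φ s y))).comp (fderiv ℝ V (Φ s y)) +
          (innerSL ℝ (V (Φ s y))).comp (fderiv ℝ V (Φ s y))) - fderiv ℝ P (Φ s y)) (Φ s y) := by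
    have h := (hVd (Φ s y)).hasFDerivAt.norm_sq
    rw [two_smul] at h
    exact (h.const_mul (1 / 2 : ℝ)).sub (hPd (Φ s y)).hasFDerivAt
  have hGw : ∀ w, fderiv ℝ (fun z => (1 / 2 : ℝ) * ‖V z‖ ^ 2 - P z) (Φ s y) w =
      ⟪V (Φ s y), fderiv ℝ V (Φ s y) w⟫ - fderiv ℝ P (Φ s y) w := by
    intro w
    rw [hG.fderiv]
    simp only [_root_.sub_apply, _root_.smul_apply, _root_.add_apply,
      ContinuousLinearMap.coe_comp, Function.comp_apply, innerSL_apply_apply, smul_eq_mul]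
    ring
  -- the profile equation at `Φ_s y`
  have hPe : fderiv ℝ V (Φ s y) (selfSimilarTransport γ 0 V (Φ s y)) =
      -((1 - γ) • V (Φ s y)) - gradient P (Φ s y) := by
    have h := hprof.profile_eq (Φ s y)
    rw [selfSimilarTransport_apply]
    calc fderiv ℝ V (Φ s y) (γ • (Φ s y - 0) + V (Φ s y))
        = ((1 - γ) • V (Φ s y) + fderiv ℝ V (Φ s y) (γ • (Φ s y - 0) + V (Φ s y)) +
            gradient P (Φ s y)) - (1 - γ) • V (Φ s y) - gradient P (Φ s y) := by abel
      _ = -((1 - γ) • V (Φ s y)) - gradient P (Φ s y) := by rw [h]; abel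
  refine h3.congr_deriv ?_
  rw [hGw, hPe]
  simp only [_root_.add_apply, _root_.smul_apply, ContinuousLinearMap.id_apply, inner_add_right,
    inner_smul_right, inner_sub_left, inner_neg_left, inner_smul_left, inner_gradient_left,
    RCLike.conj_to_real]
  ring

/-- **Integration by parts against a divergence-free test field**: `∫ Dθ(y)[B y] dy = 0` for
`θ ∈ C¹` and `B ∈ C¹_c` with `div B = 0`. [cite: Leray1934, §6 (1.11) p. 203] -/
theorem integral_fderiv_apply_eq_zero_of_isDivFree {θ : EuclideanSpace ℝ (Fin 3) → ℝ}
    (hθ : ContDiff ℝ 1 θ) {B : EuclideanSpace ℝ (Fin 3) → EuclideanSpace ℝ (Fin 3)}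
    (hB : ContDiff ℝ 1 B) (hBc : HasCompactSupport B) (hBdiv : VectorCalculus.IsDivFree B) :
    ∫ y, fderiv ℝ θ y (B y) = 0 := by
  have h := integral_mul_divergence_add_eq_zero_right hθ hB hBc
  have h0 : (fun x => θ x * VectorCalculus.divergence B x) = fun _ => 0 := by
    funext x; rw [hBdiv x, mul_zero]
  rw [h0, integral_zero, zero_add] at h
  have h1 : (fun y => fderiv ℝ θ y (B y)) = fun y => ⟪B y, gradient θ y⟫ := by
    funext y; rw [real_inner_comm, inner_gradient_left]
  rw [h1, h]

/-- **The self-similar Kelvin law, paired against a divergence-free test field** (CIV 2026 §3.4.2: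
`e^{(1−2γ)τ} Γ(τ) = Γ(0)` for the circulation `Γ(τ)` of `U` along the image `Y(C(0), τ)` of a
loop; here the loop is replaced by a compactly supported divergence-free field `B`, i.e. an
average over a solid torus of loops): for every `s`,
`∫ ⟪V(Φ_s y), DΦ_s(y) B(y)⟫ dy = e^{(2γ−1)s} ∫ ⟪V, B⟫`.
[cite: ConstantinIgnatovaVicol2026Putative, §3.4.2 (self-similar Kelvin circulation theorem)] -/
theorem integral_inner_flow_eq_exp_mul (hV : ContDiff ℝ ∞ V) {K : ℝ} (hK : ∀ y, ‖fderiv ℝ V y‖ ≤ K)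
    {P : EuclideanSpace ℝ (Fin 3) → ℝ} (hprof : IsSelfSimilarEulerProfile γ 0 V P)
    {B : EuclideanSpace ℝ (Fin 3) → EuclideanSpace ℝ (Fin 3)} (hB : ContDiff ℝ ∞ B)
    (hBc : HasCompactSupport B) (hBdiv : VectorCalculus.IsDivFree B) (s : ℝ) :
    ∫ y, ⟪V (ODE.evolutionMap (fun _ : ℝ => selfSimilarTransport γ 0 V) 0 s y),
        fderiv ℝ (ODE.evolutionMap (fun _ : ℝ => selfSimilarTransport γ 0 V) 0 s) y (B y)⟫ =
      Real.exp ((2 * γ - 1) * s) * ∫ y, ⟪V y, B y⟫ := by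
  set Φ := ODE.evolutionMap (fun _ : ℝ => selfSimilarTransport γ 0 V) 0 with hΦ
  -- the renormalised integrand `F(r, y) = e^{−(2γ−1)r} ⟪V(Φ_r y), DΦ_r(y) B(y)⟫`
  set F : ℝ → EuclideanSpace ℝ (Fin 3) → ℝ :=
    fun r y => Real.exp (-((2 * γ - 1) * r)) * ⟪V (Φ r y), fderiv ℝ (Φ r) y (B y)⟫ with hF
  -- joint smoothness
  have hΦs : IsSmoothSpaceTimeOn univ Φ := isSmoothSpaceTimeOn_flow (γ := γ) hV hK
  have hVΦ : IsSmoothSpaceTimeOn univ (fun r y => V (Φ r y)) := by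
    have h : ContDiffOn ℝ ∞ (V ∘ uncurry Φ) (univ ×ˢ univ) := hV.comp_contDiffOn hΦs
    exact h
  have hBs : IsSmoothSpaceTimeOn univ (fun _ : ℝ => B) :=
    IsSmoothSpaceTimeOn.of_contDiff_univ (by exact hB.comp contDiff_snd)
  have hJB : IsSmoothSpaceTimeOn univ (fun r y => fderiv ℝ (Φ r) y (B y)) :=
    (hΦs.fderiv_slice uniqueDiffOn_univ).clm_apply hBs
  have hexp : IsSmoothSpaceTimeOn univ (fun (r : ℝ) (_ : EuclideanSpace ℝ (Fin 3)) =>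
      Real.exp (-((2 * γ - 1) * r))) :=
    IsSmoothSpaceTimeOn.of_contDiff_univ
      (by exact ((contDiff_const (c := (2 * γ - 1))).mul contDiff_fst).neg.exp)
  have hFs : IsSmoothSpaceTimeOn univ F := hexp.mul (hVΦ.inner hJB)
  have hF1 : ContDiffOn ℝ 1 (uncurry F) (univ ×ˢ univ) := hFs.of_le (mod_cast le_top)
  -- uniform compact support in space
  have hsupp : ∀ r ∈ (univ : Set ℝ), ∀ y ∉ tsupport B, F r y = 0 := by
    intro r _ y hy
    simp [hF, image_eq_zero_of_notMem_tsupport hy]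
  -- the derivative of `r ↦ ∫ F r` vanishes
  have hG1 : ContDiff ℝ 1 (fun z => (1 / 2 : ℝ) * ‖V z‖ ^ 2 - P z) :=
    ((hprof.contDiff_velocity.of_le (by norm_num)).norm_sq ℝ |>.const_smul (1 / 2 : ℝ)).sub
      hprof.contDiff_pressure
  have hderiv : ∀ r, HasDerivAt (fun r => ∫ y, F r y) 0 r := by
    intro r
    have h := hasDerivAt_integral_of_contDiffOn (μ := volume) isOpen_univ hF1 hBc.isCompact hsupp
      (mem_univ r)
    -- identify the derivative of the time line
    have hline : ∀ y, deriv (fun r => F r y) r = Real.exp (-((2 * γ - 1) * r)) *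
        fderiv ℝ (fun y => (1 / 2 : ℝ) * ‖V (Φ r y)‖ ^ 2 - P (Φ r y)) y (B y) := by
      intro y
      have h1 : HasDerivAt (fun r => Real.exp (-((2 * γ - 1) * r)))
          (Real.exp (-((2 * γ - 1) * r)) * (-(2 * γ - 1))) r := by
        simpa using (((hasDerivAt_id r).const_mul (2 * γ - 1)).neg).exp
      have h2 := hasDerivAt_inner_flow (γ := γ) hV hK hprof r y (B y)
      have h3 : HasDerivAt (fun r => F r y)
          (Real.exp (-((2 * γ - 1) * r)) * (-(2 * γ - 1)) * ⟪V (Φ r y), fderiv ℝ (Φ r) y (B y)⟫ +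
            Real.exp (-((2 * γ - 1) * r)) * ((2 * γ - 1) * ⟪V (Φ r y), fderiv ℝ (Φ r) y (B y)⟫ +
              fderiv ℝ (fun z => (1 / 2 : ℝ) * ‖V z‖ ^ 2 - P z) (Φ r y)
                (fderiv ℝ (Φ r) y (B y)))) r := h1.mul h2
      rw [h3.deriv]
      have hcomp : fderiv ℝ (fun y => (1 / 2 : ℝ) * ‖V (Φ r y)‖ ^ 2 - P (Φ r y)) y (B y) =
          fderiv ℝ (fun z => (1 / 2 : ℝ) * ‖V z‖ ^ 2 - P z) (Φ r y) (fderiv ℝ (Φ r) y (B y)) := by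
        have hc : (fun y => (1 / 2 : ℝ) * ‖V (Φ r y)‖ ^ 2 - P (Φ r y)) =
            (fun z => (1 / 2 : ℝ) * ‖V z‖ ^ 2 - P z) ∘ Φ r := rfl
        rw [hc, fderiv_comp y ((hG1.differentiable one_ne_zero) _)
          ((contDiff_flow (γ := γ) hV hK r).differentiable (by simp) y)]
        rfl
      rw [hcomp]
      ring
    simp_rw [hline, integral_const_mul] at h
    have hθ : ContDiff ℝ 1 (fun y => (1 / 2 : ℝ) * ‖V (Φ r y)‖ ^ 2 - P (Φ r y)) :=
      hG1.comp ((contDiff_flow (γ := γ) hV hK r).of_le (mod_cast le_top))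
    rwa [integral_fderiv_apply_eq_zero_of_isDivFree hθ (hB.of_le (mod_cast le_top)) hBc hBdiv,
      mul_zero] at h
  have hconst := is_const_of_deriv_eq_zero (fun r => (hderiv r).differentiableAt)
    (fun r => (hderiv r).deriv) s 0
  -- unwind at `s` and at `0`
  have h0 : (∫ y, F 0 y) = ∫ y, ⟪V y, B y⟫ := by
    refine integral_congr_ae (Eventually.of_forall fun y => ?_)
    simp [hF, hΦ, ODE.evolutionMap_self, fderiv_evolutionMap_self]
  have hs : (∫ y, F s y) = Real.exp (-((2 * γ - 1) * s)) *
      ∫ y, ⟪V (Φ s y), fderiv ℝ (Φ s) y (B y)⟫ := by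
    rw [← integral_const_mul]
  rw [hs, h0] at hconst
  have hexp0 : Real.exp ((2 * γ - 1) * s) * Real.exp (-((2 * γ - 1) * s)) = 1 := by
    rw [← Real.exp_add]; simp
  calc (∫ y, ⟪V (Φ s y), fderiv ℝ (Φ s) y (B y)⟫)
      = Real.exp ((2 * γ - 1) * s) * (Real.exp (-((2 * γ - 1) * s)) *
          ∫ y, ⟪V (Φ s y), fderiv ℝ (Φ s) y (B y)⟫) := by rw [← mul_assoc, hexp0, one_mul]
    _ = Real.exp ((2 * γ - 1) * s) * ∫ y, ⟪V y, B y⟫ := by rw [hconst]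

end Summit.NavierStokesRegularity.NavierStokesRegularity.Theorems.PowerGaugeEulerLiouville.Kelvin

end
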